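import Summits.AtomisticToContinuum.Crystallization.Theorems.HullExactificationCascadeZeroDefectDensityCombCaseC
import Summits.AtomisticToContinuum.Crystallization.Theorems.HullExactificationCascadeZeroDefectDensityCombCaseD
import Literature.Geometry.DiscreteGeometry.TameContactGraphs
import Literature.Geometry.DiscreteGeometry.KissingPatterns
import HarnessLib

/-!
# Combinatorial classification of the soft contact map — part 7: the registered stub
# (route `HullExactificationCascade`, crux `ZeroDefectDensity`, stmt-AtomisticToContinuum-12086; line `birth`,
# stub `stub_combClassification`)

**Claim.** Let `A : Fin 12 → Fin 12 → Bool` be irreflexive, symmetric and `4`-regular, and let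
`σ v` be, for every vertex `v`, a single `4`-cycle on the neighbours of `v` (clauses 4–6) with
exactly two small corners (`a`, `σ v a` adjacent) per vertex (clause 7), small corners closing
coherently into triangles (clause 8) and large corners into quadrilaterals (clause 9).  Then the
graph `A` is, by a bijection `Fin 12 ≃ pattern`, the unit-distance graph of the FCC kissing
pattern (cuboctahedron) or of the HCP kissing pattern (anticuboctahedron) of
`Literature/Geometry/DiscreteGeometry/KissingPatterns.lean`.

**Proof.** (1) Root: vertex `0`, a neighbour `a` (degree four), the rotation `a → b → c → d`.
Of the sixteen corner patterns at the root, ten contradict "exactly two small corners" (local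
rules `cTT12` / `cFF12` of `…CombRules.lean`) and the other six are, up to the choice of the
starting neighbour, the two patterns `(s,L,s,L)` and `(s,s,L,L)` settled by the propagation
theorems `comb_sLsL` (`…CombCaseC.lean`, with `…CombCaseA/B.lean`) and `comb_ssLL`
(`…CombCaseD.lean`): kernel-checked straight-line proofs that grow the whole map from the root
and end in the FCC / HCP table `∃ c ∈ {0,1}, ∃ f, ∀ i j, A (f i) (f j) = tameAdjM c i j`.
(2) `patternEquiv_of_table`: such an `f` is injective because the two tables have pairwise
distinct rows (`decide`), hence a bijection of `Fin 12`; composing with the tree's isomorphisms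
`tameContactGraph 1 ≃g contactGraph (2 • fcc)`, `tameContactGraph 0 ≃g contactGraph (2 • hcp)`
(`TameContactGraphs.lean`, Part G) and halving (`dist (2p) (2q) = 2 ↔ dist p q = 1`) gives the
pattern bijection.  Mathlib and the tree only; no named fact is used; clause 5 (injectivity of
`σ v`) turns out not to be needed.
-/

namespace Summit.AtomisticToContinuum.Crystallization.Theorems.ZeroDefectDensityBirth

open Literature.Geometry.DiscreteGeometry Comb

/-- The FCC and HCP tables have pairwise distinct rows (no two vertices of the cuboctahedron or of
the anticuboctahedron have the same neighbours). [folklore] -/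
theorem tameAdjM_rows_ne : ∀ c : Fin 8, (c = 0 ∨ c = 1) →
    ∀ i j : Fin 12, (∀ k : Fin 12, tameAdjM c i k = tameAdjM c j k) → i = j := by
  intro c hc
  rcases hc with rfl | rfl <;> decide

/-- The FCC and HCP tables are symmetric. [folklore] -/
theorem tameAdjM_symm : ∀ c : Fin 8, (c = 0 ∨ c = 1) →
    ∀ i j : Fin 12, tameAdjM c i j = tameAdjM c j i := by
  intro c hc
  rcases hc with rfl | rfl <;> decide

/-- **Transport of a table to a pattern bijection.**  If `A (f i) (f j) = tameAdjM c i j` for a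
table `c ∈ {0, 1}` and the graph `tameContactGraph c` is isomorphic to the contact graph of the
doubled pattern `2 • P`, then `A` is the unit-distance graph of `P` along a bijection
`Fin 12 ≃ P` (`f` is a bijection by `tameAdjM_rows_ne`; halve the doubled pattern). [folklore] -/
theorem patternEquiv_of_table (A : Fin 12 → Fin 12 → Bool) {c : Fin 8} (hc : c = 0 ∨ c = 1)
    {f : Fin 12 → Fin 12} (hf : ∀ i j : Fin 12, A (f i) (f j) = tameAdjM c i j)
    (P : Finset (EuclideanSpace ℝ (Fin 3)))
    (φ : tameContactGraph c ≃g contactGraph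
      ((fun p => (2 : ℝ) • p) '' (P : Set (EuclideanSpace ℝ (Fin 3))))) :
    ∃ e : Fin 12 ≃ {q : EuclideanSpace ℝ (Fin 3) // q ∈ P},
      ∀ i j : Fin 12, i ≠ j → (A i j = true ↔ dist (e i).1 (e j).1 = 1) := by
  -- `f` is a bijection
  have hinj : Function.Injective f := by
    intro i j hij
    apply tameAdjM_rows_ne c hc
    intro k
    rw [← hf i k, ← hf j k, hij]
  obtain ⟨e₁, he₁⟩ : ∃ e₁ : Fin 12 ≃ Fin 12, ∀ i, e₁ i = f i :=
    ⟨Equiv.ofBijective f (Finite.injective_iff_bijective.mp hinj), fun i => rfl⟩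
  -- halving the doubled pattern
  obtain ⟨η, hη⟩ : ∃ η : ↥((fun p : EuclideanSpace ℝ (Fin 3) => (2 : ℝ) • p) ''
      (P : Set (EuclideanSpace ℝ (Fin 3)))) ≃ {q : EuclideanSpace ℝ (Fin 3) // q ∈ P},
      ∀ p, (η p : EuclideanSpace ℝ (Fin 3)) = (1 / 2 : ℝ) • (p : EuclideanSpace ℝ (Fin 3)) := by
    refine ⟨⟨fun p => ⟨(1 / 2 : ℝ) • (p : EuclideanSpace ℝ (Fin 3)), ?_⟩,
      fun q => ⟨(2 : ℝ) • (q : EuclideanSpace ℝ (Fin 3)), q.1, q.2, rfl⟩, ?_, ?_⟩, fun p => rfl⟩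
    · obtain ⟨x, hx, hpx⟩ := p.2
      have : (1 / 2 : ℝ) • (p : EuclideanSpace ℝ (Fin 3)) = x := by
        rw [← hpx, smul_smul]; norm_num
      rw [this]; exact hx
    · intro p
      apply Subtype.ext
      show (2 : ℝ) • ((1 / 2 : ℝ) • (p : EuclideanSpace ℝ (Fin 3))) = p
      rw [smul_smul]; norm_num
    · intro q
      apply Subtype.ext
      show (1 / 2 : ℝ) • ((2 : ℝ) • (q : EuclideanSpace ℝ (Fin 3))) = q
      rw [smul_smul]; norm_num
  refine ⟨e₁.symm.trans (φ.toEquiv.trans η), fun v w hvw => ?_⟩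
  obtain ⟨i, rfl⟩ := e₁.surjective v
  obtain ⟨j, rfl⟩ := e₁.surjective w
  have hij : i ≠ j := fun h => hvw (by rw [h])
  simp only [Equiv.trans_apply, Equiv.symm_apply_apply]
  rw [he₁, he₁, hf i j, hη, hη, dist_smul₀, show ‖(1 / 2 : ℝ)‖ = 1 / 2 by norm_num]
  have hadj : dist ((φ.toEquiv i : ↥((fun p : EuclideanSpace ℝ (Fin 3) => (2 : ℝ) • p) ''
      (P : Set (EuclideanSpace ℝ (Fin 3))))) : EuclideanSpace ℝ (Fin 3)) (φ.toEquiv j) = 2 ↔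
      (tameContactGraph c).Adj i j := φ.map_rel_iff
  constructor
  · intro h
    have h2 := hadj.2 ⟨hij, Or.inl h⟩
    rw [h2]; norm_num
  · intro h
    have h2 : dist ((φ.toEquiv i : ↥((fun p : EuclideanSpace ℝ (Fin 3) => (2 : ℝ) • p) ''
      (P : Set (EuclideanSpace ℝ (Fin 3))))) : EuclideanSpace ℝ (Fin 3)) (φ.toEquiv j) = 2 := by
      linarith
    rcases (hadj.1 h2).2 with h' | h'
    · exact h'
    · rw [tameAdjM_symm c hc]; exact h'

/-- **From the table to the two patterns**: the combinatorial conclusion of the case theorems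
gives the FCC pattern bijection (`c = 1`, `nonempty_tameContactGraph_one_iso_fcc`) or the HCP
one (`c = 0`, `nonempty_tameContactGraph_zero_iso_hcp`). [folklore] -/
theorem patterns_of_table (A : Fin 12 → Fin 12 → Bool)
    (h : ∃ c : Fin 8, (c = 0 ∨ c = 1) ∧ ∃ f : Fin 12 → Fin 12, ∀ i j : Fin 12, A (f i) (f j) = tameAdjM c i j) :
    (∃ e : Fin 12 ≃ {q : EuclideanSpace ℝ (Fin 3) // q ∈ fccKissingPattern},
      ∀ i j : Fin 12, i ≠ j → (A i j = true ↔ dist (e i).1 (e j).1 = 1)) ∨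
    (∃ e : Fin 12 ≃ {q : EuclideanSpace ℝ (Fin 3) // q ∈ hcpKissingPattern},
      ∀ i j : Fin 12, i ≠ j → (A i j = true ↔ dist (e i).1 (e j).1 = 1)) := by
  obtain ⟨c, hc, f, hf⟩ := h
  rcases hc with rfl | rfl
  · exact Or.inr (patternEquiv_of_table A (Or.inl rfl) hf hcpKissingPattern
      nonempty_tameContactGraph_zero_iso_hcp.some)
  · exact Or.inl (patternEquiv_of_table A (Or.inr rfl) hf fccKissingPattern
      nonempty_tameContactGraph_one_iso_fcc.some)

/-- **STUB `stub_combClassification` (registered signature, line `birth`).**  A rotation system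
on a `4`-regular graph on twelve vertices whose traced faces are triangles and quadrilaterals, two
of each at every vertex (clauses as produced by `stub_localStructure`), is — as a graph, along a
bijection with the pattern — the unit-distance graph of the FCC kissing pattern (cuboctahedron) or
of the HCP kissing pattern (anticuboctahedron).  Root at vertex `0`; the sixteen corner patterns of
the root reduce to `comb_sLsL` / `comb_ssLL` or contradict `cTT12` / `cFF12`; then
`patterns_of_table`. [folklore] -/
theorem stub_combClassification : ∀ (A : Fin 12 → Fin 12 → Bool) (σ : Fin 12 → Fin 12 → Fin 12), (∀ i : Fin 12, A i i = false) → (∀ i j : Fin 12, A i j = A j i) → (∀ i : Fin 12, (Finset.univ.filter (fun j : Fin 12 => A i j = true)).card = 4) → (∀ v a : Fin 12, A v a = true → (A v (σ v a) = true ∧ σ v a ≠ a)) → (∀ v a b : Fin 12, A v a = true → A v b = true → σ v a = σ v b → a = b) → (∀ v a : Fin 12, A v a = true → (σ v (σ v a) ≠ a ∧ σ v (σ v (σ v (σ v a))) = a)) → (∀ v : Fin 12, (Finset.univ.filter (fun a : Fin 12 => A v a = true ∧ A a (σ v a) = true)).card = 2) → (∀ v a : Fin 12, A v a = true → A a (σ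 v a) = true → (σ a (σ v a) = v ∧ σ (σ v a) v = a)) → (∀ v a : Fin 12, A v a = true → A a (σ v a) = false → ∃ w : Fin 12, A a w = true ∧ σ a w = v ∧ A w (σ v a) = true ∧ σ (σ v a) v = w ∧ σ w (σ v a) = a) → (∃ e : Fin 12 ≃ {q : EuclideanSpace ℝ (Fin 3) // q ∈ Literature.Geometry.DiscreteGeometry.fccKissingPattern}, ∀ i j : Fin 12, i ≠ j → (A i j = true ↔ dist (e i).1 (e j).1 = 1)) ∨ (∃ e : Fin 12 ≃ {q : EuclideanSpace ℝ (Fin 3) // q ∈ Literature.Geometry.DiscreteGeometry.hcpKissingPattern}, ∀ i j : Fin 12, i ≠ j → (A i j = true ↔ dist (e i).1 (e j).1 = 1)) := by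
  intro A σ hirr hsym hdeg hnx _ hcyc htwo htri hquad
  apply patterns_of_table A
  -- the root: vertex `0`, a neighbour `a`, the rotation `a → b → c → d → a`
  have hne : (Finset.univ.filter (fun j : Fin 12 => A 0 j = true)).Nonempty := by
    rw [← Finset.card_pos, hdeg]; norm_num
  obtain ⟨a, ha⟩ := hne
  simp only [Finset.mem_filter, Finset.mem_univ, true_and] at ha
  obtain ⟨b, sab⟩ : ∃ b, σ 0 a = b := ⟨_, rfl⟩
  obtain ⟨c, sbc⟩ : ∃ c, σ 0 b = c := ⟨_, rfl⟩
  obtain ⟨d, scd⟩ : ∃ d, σ 0 c = d := ⟨_, rfl⟩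
  have hb : A 0 b = true := sg_adj hnx ha sab
  have hc : A 0 c = true := sg_adj hnx hb sbc
  have hd : A 0 d = true := sg_adj hnx hc scd
  have sda : σ 0 d = a := sg4 hcyc ha sab sbc scd
  -- the sixteen corner patterns `(ab, bc, cd, da)`
  cases hab : A a b <;> cases hbc : A b c <;> cases hcd : A c d <;> cases hda : A d a
  · exact (tf (cFF12 hdeg hnx hcyc htwo ha sab sbc scd hab hbc).1 hcd).elim
  · exact (tf (cFF12 hdeg hnx hcyc htwo ha sab sbc scd hab hbc).1 hcd).elim
  · exact (tf (cFF12 hdeg hnx hcyc htwo ha sab sbc scd hab hbc).2 hda).elim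
  · exact comb_ssLL hirr hsym hdeg hnx hcyc htwo htri hquad 0 c d a b hc scd sda sab hcd hda hab hbc
  · exact (tf (cFF12 hdeg hnx hcyc htwo hc scd sda sab hcd hda).1 hab).elim
  · exact comb_sLsL hirr hsym hdeg hnx hcyc htwo htri hquad 0 b c d a hb sbc scd sda hbc hcd hda hab
  · exact comb_ssLL hirr hsym hdeg hnx hcyc htwo htri hquad 0 b c d a hb sbc scd sda hbc hcd hda hab
  · exact (tf hda (cTT12 hnx hcyc htwo hb sbc scd sda hbc hcd).1).elim
  · exact (tf (cFF12 hdeg hnx hcyc htwo hb sbc scd sda hbc hcd).1 hda).elim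
  · exact comb_ssLL hirr hsym hdeg hnx hcyc htwo htri hquad 0 d a b c hd sda sab sbc hda hab hbc hcd
  · exact comb_sLsL hirr hsym hdeg hnx hcyc htwo htri hquad 0 a b c d ha sab sbc scd hab hbc hcd hda
  · exact (tf hab (cTT12 hnx hcyc htwo hc scd sda sab hcd hda).1).elim
  · exact comb_ssLL hirr hsym hdeg hnx hcyc htwo htri hquad 0 a b c d ha sab sbc scd hab hbc hcd hda
  · exact (tf hda (cTT12 hnx hcyc htwo ha sab sbc scd hab hbc).2).elim
  · exact (tf hcd (cTT12 hnx hcyc htwo ha sab sbc scd hab hbc).1).elim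
  · exact (tf hcd (cTT12 hnx hcyc htwo ha sab sbc scd hab hbc).1).elim

end Summit.AtomisticToContinuum.Crystallization.Theorems.ZeroDefectDensityBirth
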